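import Literature.NumberTheory.EllipticCurves.HuShuYin2019.SylvesterHeegnerHeightDisplay
import HarnessLib

/-!
# Route `SylvesterTwoHeegnerIndex` (rung K7t), item 19802 `HSYPointTwoDivisibleSevenModNine`:
# the SINGLE-CURVE («Yin») layer — three fact-free NAMED statements (hypothesis shapes)

Cell `bsd-cm`, seat `bsd-cm-two` (prover-bsd-cm-two-g8-0). PARTITION (D55): CornerF at `p = 2`
(B14/O12) × {`x³ + y³ = p` : `p ≡ 4, 7 (mod 9)` prime, NO cube condition} × `p = 2` —
types-the-object-of; closes no cell and no item; BSD is not claimed. Route-posited statements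
(D-0014: problem side), NO named Literature fact inside, nothing asserted: three `def … : Prop`.
This module imports NO `Theses` file (build rule of 2026-08-26: it is a library, not a closer).

Background (MEMO bsd-cm-two v2.8 §42, v2.9 §46). H. Yin's two 2026 PREPRINTS — arXiv:2605.25917
(Sylvester's conjecture for every prime `p ≡ 4, 7 (mod 9)`) and arXiv:2607.01744 (the Gross–Zagier
formula for them) — give, for EVERY prime `p ≡ 4, 7 (mod 9)` (no condition on `3 mod p`), ONE CM point
`Z_p = ϕ∘φ(τ_r) ∈ E_p(K)` on the curve ITSELF over its CM field `K = ℚ(√−3)` (no trace, no twin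
curve), with `L′(E_p, 1)/Ω = 2^{δ}·ĥ_ℚ(Z_p)`, `δ = 0 | −1` for `p ≡ 4 | 7 (mod 9)` (Thm. 1.1), and the
Tamagawa/torsion data `c₃ = 2^{−δ}`, `c_p = 3`, `#E_p(ℚ)_tors = 3` on Yin's model `y² = x³ + p²/4`
((3.5.3), from [Ste68]). In the tree's currency (`B` a globally minimal model of `cubeSumCurve p`,
`#Ш_an(B) = shaAn B` Miller's analytic order, heights relative to `K` on `B_K`, the rational generator
in `ι`-form as in x1b GEN 48's `HuShuYin2019.shaAnPair_mul_height_eq_two_zpow_mul_height`) this reads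
`(u·#Ш_an(B))·ĥ_K(ι P) = 2^{2δ}·ĥ_K(Y)` with `Y = ψ([√−3] Z_p)` (`ψ` the `3`-isogeny to `B`) and `u` a
POWER OF `3` (the `3`-isogeny `y² = x³ + 16p² → y² = x³ − 432p²` moves the BSD quotient and the
regulator by powers of `3` only) — i.e. up to a `2`-ADIC UNIT, which is all the `2`-adic conclusions use.

* `YinHeightDisplay` — that display as a HYPOTHESIS SHAPE (one curve: the exact analogue of x1b's
  printed two-curve display with `A`, `qA` and the cube condition removed and the unit `u` added).
  It is NOT a Literature fact: both sources are unrefereed (2026); whether they enter the tree as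
  `@[claim]` facts is the planner's / tribunal's call, untouched here. Consumers take
  `(hY : YinHeightDisplay)`.
* `YinPointTwoDivisibleSevenModNine` — MEMO v2.8 §42 **CONJECTURE C′** typed in the grammar of item
  19802 (THEOREM C) minus the twin: for `p ≡ 7 (mod 9)` EVERY `Y ∈ B(K)` standing in Yin's display
  position against the generator (any `2`-adic unit `u`) is `2`-divisible modulo torsion. For Yin's own
  point this is «`[√−3]Z_p ∈ 2E_p(K) + tors`», stated on p. 12 of arXiv:2607.01744 as BSD's PREDICTION
  («[√−3]φ(τ_r) is usually … twice the generator (… N = 27p)»), proved nowhere; numerically 22/22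
  (MEMO §44, kit j259030/j259250/j259899/j259995/j259329).
* `ShaAnTwoIntegralSevenModNine` — the same content read through the display: `#Ш_an(E_p)` is a
  `2`-ADIC INTEGER for every prime `p ≡ 7 (mod 9)` (single curve; compare the pair statement
  `SylvesterTwoNonneg.PairProductTwoIntegralSevenModNine` of item 19802's universe).

The theorems about these shapes (parity and range of `ord₂ #Ш_an(E_p)` for all `p ≡ 4, 7 (9)`;
`C′ ⟺ 2-integrality`; **`C′ ⟹ THEOREM C`** given the rank-`0` CM BSD of the twin) are in
`…Theorems.SylvesterTwoHeegnerIndexYinIndex`.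

## References
* H. Yin, *Gross–Zagier formula for the 4, 7 cases of Sylvester's conjecture*, arXiv:2607.01744
  (2 Jul 2026), Thm. 1.1 (p. 2), (3.5.2)–(3.5.3) and the Tamagawa table (pp. 11–12). PREPRINT.
* H. Yin, *(Sylvester's conjecture, the cases p ≡ 4, 7 mod 9)*, arXiv:2605.25917 (2026), §4 (the CM
  point), §6 (Manin constant a unit). PREPRINT.
* Y. Hu, J. Shu, H. Yin, Trans. AMS 372 (2019) = arXiv:1708.05266, p. 12 display (bsd) (the two-curve
  display typed as `HuShuYin2019.shaAnPair_mul_height_eq_two_zpow_mul_height`).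
* MEMO bsd-cm-two v2.8 §42/§44 (HOME/frozen/MEMO-bsd-cm-two.v2.8.7b10bbdf24ce5e05.md); v2.9 §46–§47.
-/

set_option autoImplicit false
-- the Summit-side namespace `Summit.BirchSwinnertonDyer.BirchSwinnertonDyer.…` (summit = problem) is mandated by D-0017
set_option linter.dupNamespace false

noncomputable section

open scoped Classical

open WeierstrassCurve WeierstrassCurve.Affine WeierstrassCurve.Affine.Point
  Literature.NumberTheory.EllipticCurves Literature.NumberTheory.EllipticCurves.HuShuYin2019

namespace Summit.BirchSwinnertonDyer.BirchSwinnertonDyer.Theorems.SylvesterTwoYin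

/-- **Yin's single-curve Gross–Zagier display, as a HYPOTHESIS SHAPE (PREPRINT content, not a
Literature fact).** For every prime `p ≡ 4, 7 (mod 9)` — no condition on `3 mod p` — and every
globally minimal `B ≅ E_p` (`C • B = cubeSumCurve p`), over every quadratic number field `K ∋ ω`
(`ω² + ω + 1 = 0`): `#Ш_an(B) = qB ≠ 0` is rational, `rank_ℤ B(K) = 2`, and there are a rational
point `P` (non-torsion, generating `B(ℚ)` modulo torsion, in `ι`-form), a point `Y ∈ B(K)` and a
rational `2`-ADIC UNIT `u` (`u ≠ 0`, `ord₂ u = 0`; in the source a power of `3`) with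
`(u·qB)·ĥ_K(ι P) = 2^{2δ}·ĥ_K(Y)`, `2δ = 0 | −2` for `p ≡ 4 | 7 (mod 9)`. Source reading: Yin,
arXiv:2607.01744 Thm. 1.1 `L′(E_p,1)/Ω = 2^{δ} ĥ_ℚ(Z_p)` with `Z_p = ϕ∘φ(τ_r) ∈ E_p(K)` non-torsion
(arXiv:2605.25917), the local constants `c₃ = 2^{−δ}`, `c_p = 3`, `#tors = 3` of (3.5.3), hence
`#Ш_an = 3·4^{δ}·ĥ(Z_p)/ĥ(P)` on Yin's model; `Y = ψ([√−3]Z_p)` on `B`; rank `2` over `K` and the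
generator by Gross–Zagier–Kolyvagin (`r_an(E_p) = 1`) and `E_p^{(−3)} ∼ E_p` (`3`-isogeny).
[claim-level reading of arXiv:2607.01744 Thm. 1.1 + (3.5.3); NOT asserted; PREPRINT 2026] -/
@[conjecture] def YinHeightDisplay : Prop :=
  ∀ (p : ℕ), p.Prime → (p % 9 = 4 ∨ p % 9 = 7) →
    ∀ (B : WeierstrassCurve ℚ) [B.IsElliptic] [B.IsGloballyMinimal],
      (∃ C : VariableChange ℚ, C • B = cubeSumCurve (p : ℚ)) →
    ∀ (K : Type) [Field K] [NumberField K] (ω : K), ω ^ 2 + ω + 1 = 0 → Module.finrank ℚ K = 2 →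
      ∃ qB : ℚ, shaAn B = (qB : ℂ) ∧ qB ≠ 0 ∧ (B.baseChange K).mordellWeilRank = 2 ∧
        ∃ (P : B.toAffine.Point) (Y : (B.baseChange K).toAffine.Point) (u : ℚ),
          u ≠ 0 ∧ padicValRat 2 u = 0 ∧
          ¬ IsOfFinAddOrder (QuadraticDescent.incl K B P) ∧
          (∀ Q : B.toAffine.Point, ∃ m : ℤ,
            IsOfFinAddOrder (QuadraticDescent.incl K B Q - m • QuadraticDescent.incl K B P)) ∧
          ((u * qB : ℚ) : ℝ) * canonicalHeight (QuadraticDescent.incl K B P) =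
            (2 : ℝ) ^ (if p % 9 = 4 then (0 : ℤ) else -2) * canonicalHeight Y

/-- **CONJECTURE C′ (MEMO bsd-cm-two v2.8 §42), typed fact-free in the grammar of item 19802 minus
the twin.** For every prime `p ≡ 7 (mod 9)` (no cube condition), every globally minimal `B ≅ E_p`,
`#Ш_an(B) = qB`, every quadratic `K ∋ ω`, every rational generator `P₀` (in `ι`-form, non-torsion,
generating modulo torsion), every `2`-adic unit `u ∈ ℚ` and EVERY `Y ∈ B(K)` with
`(u·qB)·ĥ_K(ι P₀) = 2^{−2}·ĥ_K(Y)`: **`Y ∈ 2·B(K) + B(K)_tors`**. For Yin's own point this is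
«`[√−3]·ϕ∘φ(τ_r)` is twice a `K`-generator up to torsion when `N = 27p`» — arXiv:2607.01744 p. 12
states it as the BSD prediction, proves nothing of it. OPEN; not asserted.
[cite-level reading: arXiv:2607.01744, p. 12; MEMO bsd-cm-two v2.8 §42 (Y3)] -/
@[conjecture] def YinPointTwoDivisibleSevenModNine : Prop :=
  ∀ (p : ℕ), p.Prime → p % 9 = 7 →
    ∀ (B : WeierstrassCurve ℚ) [B.IsElliptic] [B.IsGloballyMinimal],
      (∃ C : VariableChange ℚ, C • B = cubeSumCurve (p : ℚ)) →
      ∀ (qB : ℚ), shaAn B = (qB : ℂ) →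
      ∀ (K : Type) [Field K] [NumberField K] (ω : K), ω ^ 2 + ω + 1 = 0 →
        Module.finrank ℚ K = 2 →
        ∀ (P₀ : B.toAffine.Point), ¬ IsOfFinAddOrder (QuadraticDescent.incl K B P₀) →
          (∀ Q : B.toAffine.Point, ∃ m : ℤ,
            IsOfFinAddOrder (QuadraticDescent.incl K B Q - m • QuadraticDescent.incl K B P₀)) →
          ∀ (Y : (B.baseChange K).toAffine.Point) (u : ℚ), u ≠ 0 → padicValRat 2 u = 0 →
            ((u * qB : ℚ) : ℝ) * canonicalHeight (QuadraticDescent.incl K B P₀) =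
              (2 : ℝ) ^ (-2 : ℤ) * canonicalHeight Y →
            ∃ Y' T' : (B.baseChange K).toAffine.Point, IsOfFinAddOrder T' ∧ Y = (2 : ℤ) • Y' + T'

/-- **The `2`-INTEGRALITY of `#Ш_an(E_p)` on `p ≡ 7 (mod 9)`, single curve** (CONJECTURE C′ read
through Yin's display; compare the PAIR statement `SylvesterTwoNonneg.PairProductTwoIntegralSevenModNine`):
for every prime `p ≡ 7 (mod 9)` and every globally minimal `B ≅ E_p`, `0 ≤ ord₂ #Ш_an(B)`. Under
the display this is `#Ш_an(E_p) = N(β/2)` with `β/2 ∈ ℤ[ω]`. OPEN (the `2`-integrality of the analytic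
order of Ш in analytic rank one is not known in general); not asserted.
[cite-level reading: arXiv:2607.01744, p. 12; MEMO bsd-cm-two v2.8 §42 (Y3)] -/
@[conjecture] def ShaAnTwoIntegralSevenModNine : Prop :=
  ∀ (p : ℕ), p.Prime → p % 9 = 7 →
    ∀ (B : WeierstrassCurve ℚ) [B.IsElliptic] [B.IsGloballyMinimal],
      (∃ C : VariableChange ℚ, C • B = cubeSumCurve (p : ℚ)) →
      ∀ qB : ℚ, shaAn B = (qB : ℂ) → 0 ≤ padicValRat 2 qB

end Summit.BirchSwinnertonDyer.BirchSwinnertonDyer.Theorems.SylvesterTwoYin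

end
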